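import Mathlib
import HarnessLib
import Summits.RiemannHypothesis.RiemannHypothesis.Theorems.IntegerScrewHarmonicK

/-!
# Route `IntegerScrew` — analytic constants for THEOREM C♯'s bookkeeping (CONTINUUM-LIMIT 16.5):
# `K(u,0) ≤ 2·g(u)`, `u·|c(u)| ≤ 2·g(u)`, `|c(u)| ≤ g(u)` — the suprema `κ₀, κ₁, κ₂` replaced by `2, 2, 1`

CONTINUUM-LIMIT 16.5 (HOME/pivot/, rh-explicit A6-PIVOT theory; PIVOT-LAW 13.44) bounds the six terms of the exact
decomposition 16.4 of `(𝒜_D − ∂_u)h̃` through three one-variable suprema of the explicit functions of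
`IntegerScrewHarmonicKDefs`,

  `κ₀ := sup_{u>0} K(u,0)/K(u,1) = 1.4254`,  `κ₁ := sup_{u>0} u|c(u)|/K(u,1) = 1.2000`,  `κ₂ := sup_{u>0} |c(u)|/K(u,1) = 0.5705`

(`K(u,1) = g(u)`), «evaluated on a 10⁻³-grid to u = 200 with the asymptotics beyond» — the one step of THEOREM C♯'s
proof that is not a finite identity or a cited prime-number bound, and the item the kernel road map (PIVOT-LAW 13.50 (d),
guide §K (K4)) lists as needing «interval arithmetic or a coarser analytic bound».  This file supplies the COARSER
ANALYTIC BOUNDS, with complete proofs and no numerics: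

* `ccpA_le_ccpg`       : `A(u) ≤ g(u)`             (`g = A − c·e^{−u}`, `c < 0`);
* `ccpK_zero_le_two_mul_ccpA` : `K(u,0) ≤ 2·A(u)`, hence `K(u,0) ≤ 2·g(u)`      — **κ₀ ≤ 2**;
* `neg_ccpc_le_ccpA`   : `|c(u)| = −c(u) ≤ A(u)`, hence `|c(u)| ≤ g(u)`          — **κ₂ ≤ 1**;
* `mul_neg_ccpc_le_two_mul_ccpA` : `u·|c(u)| ≤ 2·A(u)`, hence `u·|c(u)| ≤ 2·g(u)` — **κ₁ ≤ 2**;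

and, since `K(u,ρ) ≥ K(u,1) = g(u)` for rooms `ρ ≤ 1` (`ccpg_le_ccpK_of_le_one`), the forms 16.5 actually divides by:
`K(u,0) ≤ 2·K(u,ρ)`, `|c(u)| ≤ K(u,ρ)`, `u·|c(u)| ≤ 2·K(u,ρ)` (`u > 0`, `ρ ≤ 1`).

All three reduce to ONE elementary inequality, `φ₀(u) := u − 2 + (u + 2)e^{−u} ≥ 0` for `u ≥ 0` (the Padé-type bound
`e^{−u} ≥ (2 − u)/(2 + u)`): `φ₀(0) = 0` and `φ₀′(u) = 1 − (1 + u)e^{−u} ≥ 0` because `1 + u ≤ e^{u}`; the `κ₁` case is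
`φ₀(u) + u²e^{−u} ≥ 0`.  CONSEQUENCE for 16.5's constants (E₂ = 1.84, C₅ = 1.227, C₆ = 0.7554 unchanged): with
`(κ₀, κ₁, κ₂) = (2, 2, 1)` the summation of 16.5 gives `ε⁺_L ≤ (2E₂κ₀ + κ₀C₅ + 0.37κ₁)/L + O(ℓ²/L²) = 10.6/L + …` and
`ε⁻_L ≤ (E₂κ₀ + C₆)/L + … = 4.44/L + …` in place of `7.5/L`, `3.4/L` — THEOREM C♯ with coarser constants and the
same `O(τ/L)` relative error, which is all THEOREMS N6₁/N6₂ use.  Calculus on `exp` only; RH-free and walk-free.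
Nothing in this file bears on the truth of RH.  References: CONTINUUM-LIMIT §16.5/16.8, PIVOT-LAW 13.44/13.50;
M. Suzuki, J. Lond. Math. Soc. (2) 108 (2023) 1448–1487 [Suzuki2023] for the screw matrices this serves.
-/

noncomputable section

-- D-0017: `Summit.<S>.<S>.…` is the designed namespace of a single-problem summit.
set_option linter.dupNamespace false

namespace Summit.RiemannHypothesis.RiemannHypothesis.Theorems.IntegerScrew

open Real

/-! ## The one elementary inequality: `u − 2 + (u+2)e^{−u} ≥ 0` on `[0, ∞)` -/

/-- `d/du [u − 2 + (u + 2)e^{−u}] = 1 − (1 + u)e^{−u}`. -/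
theorem hasDerivAt_padeDefect (u : ℝ) :
    HasDerivAt (fun x : ℝ => x - 2 + (x + 2) * exp (-x)) (1 - (1 + u) * exp (-u)) u := by
  have h3 : HasDerivAt (fun x : ℝ => exp (-x)) (-exp (-u)) u := by
    simpa using (hasDerivAt_neg u).exp
  have h : HasDerivAt (fun x : ℝ => x - 2 + (x + 2) * exp (-x))
      (1 + (1 * exp (-u) + (u + 2) * -exp (-u))) u :=
    ((hasDerivAt_id' u).sub_const 2).add (((hasDerivAt_id' u).add_const 2).mul h3)
  have e : 1 + (1 * exp (-u) + (u + 2) * -exp (-u)) = 1 - (1 + u) * exp (-u) := by ring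
  rw [e] at h
  exact h

/-- `1 − (1 + u)e^{−u} ≥ 0` for every real `u`: `(1 + u)e^{−u} ≤ 1` because `1 + u ≤ e^{u}`. -/
theorem one_sub_one_add_mul_exp_neg_nonneg (u : ℝ) : 0 ≤ 1 - (1 + u) * exp (-u) := by
  have h1 : u + 1 ≤ exp u := add_one_le_exp u
  have h2 : (1 + u) * exp (-u) ≤ 1 := by
    rw [exp_neg, ← div_eq_mul_inv, div_le_one (exp_pos u)]
    linarith
  linarith

/-- `u ↦ u − 2 + (u + 2)e^{−u}` is monotone on `ℝ`. -/
theorem monotone_padeDefect : Monotone (fun x : ℝ => x - 2 + (x + 2) * exp (-x)) := by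
  have hd : Differentiable ℝ (fun x : ℝ => x - 2 + (x + 2) * exp (-x)) :=
    fun u => (hasDerivAt_padeDefect u).differentiableAt
  refine monotone_of_deriv_nonneg hd fun u => ?_
  rw [(hasDerivAt_padeDefect u).deriv]
  exact one_sub_one_add_mul_exp_neg_nonneg u

/-- **`u − 2 + (u + 2)e^{−u} ≥ 0` for `u ≥ 0`** (value `0` at `u = 0`, monotone) — the Padé-type bound
`e^{−u} ≥ (2 − u)/(2 + u)`; stated with the product expanded, `0 ≤ u − 2 + u·e^{−u} + 2e^{−u}`. -/
theorem padeDefect_nonneg {u : ℝ} (hu : 0 ≤ u) : 0 ≤ u - 2 + u * exp (-u) + 2 * exp (-u) := by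
  have h := monotone_padeDefect hu
  simp only [zero_sub, zero_add, neg_zero, exp_zero, mul_one] at h
  nlinarith [h]

/-! ## `A ≤ g` and the three `κ`-bounds through `A` -/

/-- `A(u) ≤ g(u)` for `u > 0`: `g = K(·,1) = A − c·e^{−u}` with `c < 0`. -/
theorem ccpA_le_ccpg {u : ℝ} (hu : 0 < u) : ccpA u ≤ ccpg u := by
  rw [← ccpK_one hu.ne', ccpK_eq_ccpA_sub hu.ne']
  have hc := (ccpc_neg hu).le
  have he := (exp_pos (-(u * 1))).le
  nlinarith

/-- **κ₀ through `A`**: `K(u,0) = (1 − e^{−u})/u ≤ 2·A(u) = 2(u − 1 + e^{−u})/u²` for `u > 0`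
(⟺ `u − 2 + (u+2)e^{−u} ≥ 0`). -/
theorem ccpK_zero_le_two_mul_ccpA {u : ℝ} (hu : 0 < u) : ccpK u 0 ≤ 2 * ccpA u := by
  rw [ccpK_zero_right]
  unfold ccpA
  have hφ := padeDefect_nonneg hu.le
  have hu' : u ≠ 0 := hu.ne'
  have hu2 : 0 < u ^ 2 := by positivity
  rw [show (1 - exp (-u)) / u = (u * (1 - exp (-u))) / u ^ 2 by field_simp,
    show 2 * ((u - 1 + exp (-u)) / u ^ 2) = (2 * (u - 1 + exp (-u))) / u ^ 2 by ring,
    div_le_div_iff_of_pos_right hu2]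
  nlinarith [hφ]

/-- **κ₂ through `A`**: `|c(u)| = −c(u) = (1 − (1+u)e^{−u})/u² ≤ A(u)` for `u > 0` (⟺ the same `φ₀(u) ≥ 0`). -/
theorem neg_ccpc_le_ccpA {u : ℝ} (hu : 0 < u) : -ccpc u ≤ ccpA u := by
  unfold ccpc ccpA
  have hφ := padeDefect_nonneg hu.le
  have hu2 : 0 < u ^ 2 := by positivity
  rw [show -(((1 + u) * exp (-u) - 1) / u ^ 2) = (1 - (1 + u) * exp (-u)) / u ^ 2 by ring,
    div_le_div_iff_of_pos_right hu2]
  nlinarith [hφ]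

/-- **κ₁ through `A`**: `u·|c(u)| = (1 − (1+u)e^{−u})/u ≤ 2·A(u)` for `u > 0`
(⟺ `u − 2 + (u² + u + 2)e^{−u} ≥ 0`, which is `φ₀(u) + u²e^{−u} ≥ 0`). -/
theorem mul_neg_ccpc_le_two_mul_ccpA {u : ℝ} (hu : 0 < u) : u * (-ccpc u) ≤ 2 * ccpA u := by
  unfold ccpc ccpA
  have hφ := padeDefect_nonneg hu.le
  have he := (exp_pos (-u)).le
  have hu2 : 0 < u ^ 2 := by positivity
  have hue : 0 ≤ u ^ 2 * exp (-u) := mul_nonneg hu2.le he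
  rw [show u * -(((1 + u) * exp (-u) - 1) / u ^ 2) = (u * (1 - (1 + u) * exp (-u))) / u ^ 2 by ring,
    show 2 * ((u - 1 + exp (-u)) / u ^ 2) = (2 * (u - 1 + exp (-u))) / u ^ 2 by ring,
    div_le_div_iff_of_pos_right hu2]
  nlinarith [hφ, hue]

/-! ## The `κ`-bounds through `g = K(·,1)` and through `K(u,ρ)`, `ρ ≤ 1` — the forms CONTINUUM-LIMIT 16.5 uses -/

/-- **κ₀ ≤ 2**: `K(u,0) ≤ 2·g(u)` (`u > 0`). -/
theorem ccpK_zero_le_two_mul_ccpg {u : ℝ} (hu : 0 < u) : ccpK u 0 ≤ 2 * ccpg u := by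
  have h1 := ccpK_zero_le_two_mul_ccpA hu
  have h2 := ccpA_le_ccpg hu
  linarith

/-- **κ₂ ≤ 1**: `|c(u)| ≤ g(u)` (`u > 0`). -/
theorem abs_ccpc_le_ccpg {u : ℝ} (hu : 0 < u) : |ccpc u| ≤ ccpg u := by
  rw [abs_of_neg (ccpc_neg hu)]
  exact (neg_ccpc_le_ccpA hu).trans (ccpA_le_ccpg hu)

/-- **κ₁ ≤ 2**: `u·|c(u)| ≤ 2·g(u)` (`u > 0`). -/
theorem mul_abs_ccpc_le_two_mul_ccpg {u : ℝ} (hu : 0 < u) : u * |ccpc u| ≤ 2 * ccpg u := by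
  rw [abs_of_neg (ccpc_neg hu)]
  have h1 := mul_neg_ccpc_le_two_mul_ccpA hu
  have h2 := ccpA_le_ccpg hu
  linarith

/-- `K(u,0) ≤ 2·K(u,ρ)` for `u > 0` and rooms `ρ ≤ 1` (16.5 (a), (e): `|F(ρ)|, F(ρ) − F(0), K(u,ρ−aθ_q)φ ≤ K(u,0) ≤ κ₀K`). -/
theorem ccpK_zero_le_two_mul_ccpK {u : ℝ} (hu : 0 < u) {ρ : ℝ} (hρ : ρ ≤ 1) : ccpK u 0 ≤ 2 * ccpK u ρ := by
  have h1 := ccpK_zero_le_two_mul_ccpg hu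
  have h2 := ccpg_le_ccpK_of_le_one hu hρ
  linarith

/-- `|c(u)| ≤ K(u,ρ)` for `u > 0`, `ρ ≤ 1` (16.5 (f): `min(κ₂, κ₁v_pθ_p)`). -/
theorem abs_ccpc_le_ccpK {u : ℝ} (hu : 0 < u) {ρ : ℝ} (hρ : ρ ≤ 1) : |ccpc u| ≤ ccpK u ρ :=
  (abs_ccpc_le_ccpg hu).trans (ccpg_le_ccpK_of_le_one hu hρ)

/-- `u·|c(u)| ≤ 2·K(u,ρ)` for `u > 0`, `ρ ≤ 1` (16.5 (b)–(d), (f): every `uaθ|c| ≤ κ₁K·aθ/…` step). -/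
theorem mul_abs_ccpc_le_two_mul_ccpK {u : ℝ} (hu : 0 < u) {ρ : ℝ} (hρ : ρ ≤ 1) :
    u * |ccpc u| ≤ 2 * ccpK u ρ := by
  have h1 := mul_abs_ccpc_le_two_mul_ccpg hu
  have h2 := ccpg_le_ccpK_of_le_one hu hρ
  linarith

/-- The (H1)-increment bound in the form 16.5 (b)–(d) use it: for `u > 0`, `x ≥ 0` and any room `r`,
`0 ≤ K(u,r) − K(u,r+x) ≤ u·x·|c(u)|` (from (H1): the increment is `(1 − e^{−ux})e^{−ur}|c|` with
`e^{−ur} ≤ 1` for `r ≥ 0` and `1 − e^{−ux} ≤ ux`). -/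
theorem ccpK_sub_ccpK_add_le {u : ℝ} (hu : 0 < u) {r x : ℝ} (hr : 0 ≤ r) (hx : 0 ≤ x) :
    ccpK u r - ccpK u (r + x) ≤ u * x * |ccpc u| := by
  have h := ccpK_add_sub hu.ne' r x
  rw [abs_of_neg (ccpc_neg hu)]
  have h1 : 0 ≤ 1 - exp (-(u * x)) := by
    rw [sub_nonneg]; exact exp_le_one_iff.mpr (by nlinarith)
  have h1' : 1 - exp (-(u * x)) ≤ u * x := by
    have := add_one_le_exp (-(u * x)); linarith
  have h2 : exp (-(u * r)) ≤ 1 := exp_le_one_iff.mpr (by nlinarith)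
  have h2' := (exp_pos (-(u * r))).le
  have h3 := (ccpc_neg hu).le
  have h4 : (1 - exp (-(u * x))) * exp (-(u * r)) ≤ u * x := by
    calc (1 - exp (-(u * x))) * exp (-(u * r)) ≤ (1 - exp (-(u * x))) * 1 :=
          mul_le_mul_of_nonneg_left h2 h1
      _ ≤ u * x := by linarith
  have h5 : 0 ≤ (1 - exp (-(u * x))) * exp (-(u * r)) := mul_nonneg h1 h2'
  nlinarith

/-- And its sign: `K(u,r+x) ≤ K(u,r)` restated as `0 ≤ K(u,r) − K(u,r+x)` (`u > 0`, `x ≥ 0`). -/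
theorem ccpK_sub_ccpK_add_nonneg {u : ℝ} (hu : 0 < u) (r : ℝ) {x : ℝ} (hx : 0 ≤ x) :
    0 ≤ ccpK u r - ccpK u (r + x) := by
  have := ccpK_add_le hu r hx; linarith

end Summit.RiemannHypothesis.RiemannHypothesis.Theorems.IntegerScrew

end
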